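import Summits.CriticalPhenomena.SAWScalingLimit.Theorems.SAWLeftRightFKGLeftRightFKGTP2Defs
import Summits.CriticalPhenomena.SAWScalingLimit.Theorems.SAWLeftRightFKGLeftRightFKGStubEndpointMonotoneAux2
import Summits.CriticalPhenomena.SAWScalingLimit.Theorems.SAWLeftRightFKGLeftRightFKGStubLensDichotomy
import HarnessLib

/-!
# Stub `stub_classDictionary` of line `corner-localisation` (lead c1 reshape v5)

Crux `LeftRightFKG` (stmt-CriticalPhenomena-11232), vocabulary modules
`Summits.CriticalPhenomena.SAWScalingLimit.Theorems.SAWLeftRightFKGLeftRightFKGDefs` (`cls`, `AgreeTo`,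
`AgreeToR`) and `…TP2Defs` (`fixedSet`, `freeGraph`, `dirSet`, `ClassDictionaryAt`).

THE CLASS DICTIONARY (`ClassDictionaryAt Ω δ a b`, pure walk combinatorics): in a prefix/suffix class
`cls k π m σ` of chords `a → b` of `Ω_δ` containing two distinct chords, for free `u ∼ π k` and free
`w ∼ σ m` the chords with next step `u` and previous step `w` (`dirSet k π m σ u w`) correspond bijectively
to the self-avoiding paths `u → w` of the free graph `freeGraph Ω δ k π m σ`, lengths dropping by
`k + m + 2`, the vertices of the path being the vertices of the chord at free positions.

Proof. Everything is phrased through SUPPORT LISTS (a walk is determined by its support,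
`SimpleGraph.Walk.ext_support`; a chord by its walk; a path by its walk):
* `support_eq`: the support of a chord `γ` of the class with `k + m + 1 ≤ |γ|` is
  `[π 0, …, π k] ++ middle ++ reverse [σ 0, …, σ m]`,
  `middle = (support.drop (k + 1)).take (|γ| - m - k - 1)`;
* `le_length`: two distinct chords of the class force `k + m + 1 ≤ |γ|` for each of them (otherwise
  prefix and suffix windows cover the chord: `LensDichotomy.length_eq_of_agree`,
  `LensDichotomy.eq_of_agree_of_length_le`);
* `exists_middle`: the middle of a chord of `dirSet k π m σ u w` (free `u`) is a path `u → w` of the free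
  graph (its vertices sit at free positions, which by self-avoidance miss `fixedSet`);
* `exists_chord`: conversely prefix-of-`γ₀` `++ (π k → u) ++ P ++ (w → σ m) ++` suffix-of-`γ₀` is
  a chord of `dirSet k π m σ u w` with support `[π 0, …, π k] ++ P.support ++ reverse [σ 0, …, σ m]`
  (self-avoiding: the vertices of `P` miss `fixedSet`, prefix `++` suffix is a sublist of the support
  of the path `γ₀`).
The two constructions are mutually inverse by the support formulae.
-/

noncomputable section

open MeasureTheory SimpleGraph
open Literature.Probability.LatticeModels Literature.Probability.RandomPlanarGeometry
open scoped Classical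

namespace Summit.CriticalPhenomena.SAWScalingLimit.Theorems.LeftRightFKG.CornerLoc

namespace ClassDictionary

variable {Ω : Set ℂ} {δ : ℝ} {a b : Site 2} {k : ℕ} {π : ℕ → Site 2} {m : ℕ} {σ : ℕ → Site 2}

/-! ## Lengths and supports of the chords of a class -/

/-- Two distinct chords of a prefix/suffix class are both at least `k + m + 1` long (stated for the
first): otherwise the prefix and suffix windows cover the shorter chord and determine it. [folklore] -/
theorem le_length {γ γ' : SAW.DomainSAW Ω δ a b} (hγ : γ ∈ cls k π m σ) (hγ' : γ' ∈ cls k π m σ)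
    (hne : γ ≠ γ') : k + m + 1 ≤ γ.length := by
  obtain ⟨hk, hm⟩ := EndpointMonotone.lt_length_of_ne hγ hγ' hne
  obtain ⟨hk', hm'⟩ := EndpointMonotone.lt_length_of_ne hγ' hγ hne.symm
  obtain ⟨ha, hr⟩ : AgreeTo k π γ ∧ AgreeToR m σ γ := hγ
  obtain ⟨ha', hr'⟩ : AgreeTo k π γ' ∧ AgreeToR m σ γ' := hγ'
  have hK : ∀ i ≤ k, γ.walk.getVert i = γ'.walk.getVert i :=
    fun i hi => (ha i hi).trans (ha' i hi).symm
  have hM : ∀ j ≤ m, γ.walk.reverse.getVert j = γ'.walk.reverse.getVert j :=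
    fun j hj => (hr j hj).trans (hr' j hj).symm
  have e : γ.length = γ.walk.length := rfl
  have e' : γ'.length = γ'.walk.length := rfl
  by_contra h
  have hl := LensDichotomy.length_eq_of_agree γ'.isPath hK hM (by omega) (by omega) (by omega)
    (by omega)
  exact hne (EndpointMonotone.ext_walk (LensDichotomy.eq_of_agree_of_length_le hK hM hl.symm
    (by omega)))

/-- SUPPORT FORMULA: the support of a chord of `cls k π m σ` of length `≥ k + m + 1` is
`[π 0, …, π k] ++ middle ++ reverse [σ 0, …, σ m]`. [folklore] -/
theorem support_eq {γ : SAW.DomainSAW Ω δ a b} (hγ : γ ∈ cls k π m σ) (hL : k + m + 1 ≤ γ.length) :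
    γ.walk.support = (List.range (k + 1)).map π ++
      (γ.walk.support.drop (k + 1)).take (γ.length - m - (k + 1)) ++
        ((List.range (m + 1)).map σ).reverse := by
  obtain ⟨ha, hr⟩ : AgreeTo k π γ ∧ AgreeToR m σ γ := hγ
  have e : γ.length = γ.walk.length := rfl
  have hs : γ.walk.support.length = γ.walk.length + 1 := γ.walk.length_support
  have hX : γ.walk.support.take (k + 1) = (List.range (k + 1)).map π := by
    refine List.ext_getElem (by simp only [List.length_take, List.length_map, List.length_range]; omega)
      fun i h₁ h₂ => ?_
    have hi : i ≤ k := by simp only [List.length_map, List.length_range] at h₂; omega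
    simp only [List.getElem_take, List.getElem_map, List.getElem_range,
      Walk.support_getElem_eq_getVert]
    exact ha i hi
  have hY : γ.walk.support.drop (γ.length - m) = ((List.range (m + 1)).map σ).reverse := by
    refine List.ext_getElem (by
      simp only [List.length_drop, List.length_reverse, List.length_map, List.length_range]; omega)
      fun i h₁ h₂ => ?_
    have hi : i ≤ m := by
      simp only [List.length_reverse, List.length_map, List.length_range] at h₂; omega
    simp only [List.getElem_drop, List.getElem_reverse, List.getElem_map, List.getElem_range,
      List.length_map, List.length_range, Walk.support_getElem_eq_getVert]
    rw [show m + 1 - 1 - i = m - i by omega, ← hr (m - i) (by omega), Walk.getVert_reverse]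
    congr 1
    omega
  calc γ.walk.support = γ.walk.support.take (k + 1) ++ γ.walk.support.drop (k + 1) :=
        (List.take_append_drop _ _).symm
    _ = γ.walk.support.take (k + 1) ++
          ((γ.walk.support.drop (k + 1)).take (γ.length - m - (k + 1)) ++
            (γ.walk.support.drop (k + 1)).drop (γ.length - m - (k + 1))) := by
        rw [List.take_append_drop (γ.length - m - (k + 1)) (γ.walk.support.drop (k + 1))]
    _ = _ := by
        rw [List.drop_drop, show k + 1 + (γ.length - m - (k + 1)) = γ.length - m by omega, hX, hY,
          List.append_assoc]

/-- The fixed set is the set of members of `[π 0, …, π k] ++ reverse [σ 0, …, σ m]`. [folklore] -/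
theorem mem_fixedSet_iff {v : Site 2} :
    v ∈ fixedSet k π m σ ↔ v ∈ (List.range (k + 1)).map π ++ ((List.range (m + 1)).map σ).reverse := by
  simp only [fixedSet, Set.mem_setOf_eq, List.mem_append, List.mem_map, List.mem_range,
    List.mem_reverse, Nat.lt_succ_iff]

/-- The vertices of a chord of the class at FREE positions (`k < i < |γ| - m`) are not fixed: the chord
is self-avoiding and the fixed vertices sit at positions `≤ k` and `≥ |γ| - m`. [folklore] -/
theorem getVert_not_mem_fixedSet {γ : SAW.DomainSAW Ω δ a b} (hγ : γ ∈ cls k π m σ) {i : ℕ}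
    (hki : k < i) (him : i + m < γ.length) : γ.walk.getVert i ∉ fixedSet k π m σ := by
  obtain ⟨ha, hr⟩ : AgreeTo k π γ ∧ AgreeToR m σ γ := hγ
  have e : γ.length = γ.walk.length := rfl
  have inj := γ.isPath.getVert_injOn
  rintro (⟨i', hi', hv⟩ | ⟨j, hj, hv⟩)
  · rw [← ha i' hi'] at hv
    have := inj (show i' ∈ {n | n ≤ γ.walk.length} by simp only [Set.mem_setOf_eq]; omega)
      (show i ∈ {n | n ≤ γ.walk.length} by simp only [Set.mem_setOf_eq]; omega) hv
    omega
  · rw [← hr j hj, Walk.getVert_reverse] at hv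
    have := inj (show γ.walk.length - j ∈ {n | n ≤ γ.walk.length} by
        simp only [Set.mem_setOf_eq]; omega)
      (show i ∈ {n | n ≤ γ.walk.length} by simp only [Set.mem_setOf_eq]; omega) hv
    omega

/-! ## Walks of the free graph -/

/-- The vertices of a walk of the free graph from a free vertex are free. [folklore] -/
theorem not_mem_fixedSet_of_mem_support {u w : Site 2} (P : (freeGraph Ω δ k π m σ).Walk u w)
    (hu : u ∉ fixedSet k π m σ) {v : Site 2} (hv : v ∈ P.support) : v ∉ fixedSet k π m σ := by
  induction P with
  | nil =>
    rw [Walk.support_nil, List.mem_singleton] at hv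
    exact hv ▸ hu
  | cons h q ih =>
    rw [Walk.support_cons, List.mem_cons] at hv
    rcases hv with rfl | hv
    · exact hu
    · exact ih h.2.2 hv

/-- A walk of `Ω_δ` through free vertices only is a walk of the free graph (its edges are free).
[folklore] -/
theorem edges_mem_edgeSet_freeGraph {x y : Site 2} (p : (discreteDomainGraph Ω δ).Walk x y)
    (h : ∀ v ∈ p.support, v ∉ fixedSet k π m σ) :
    ∀ e ∈ p.edges, e ∈ (freeGraph Ω δ k π m σ).edgeSet := by
  intro e
  refine Sym2.inductionOn e fun x y he => ?_
  rw [mem_edgeSet]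
  exact ⟨p.adj_of_mem_edges he, h x (p.fst_mem_support_of_mem_edges he),
    h y (p.snd_mem_support_of_mem_edges he)⟩

/-! ## The two constructions -/

/-- FORWARD: the free middle of a chord of `dirSet k π m σ u w` (`u` free) is a self-avoiding path
`u → w` of the free graph whose support is the middle of the support of the chord. [folklore] -/
theorem exists_middle {u w : Site 2} {γ : SAW.DomainSAW Ω δ a b} (hγ : γ ∈ dirSet k π m σ u w)
    (hL : k + m + 1 ≤ γ.length) (hu : u ∉ fixedSet k π m σ) :
    ∃ P : (freeGraph Ω δ k π m σ).Path u w,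
      P.1.support = (γ.walk.support.drop (k + 1)).take (γ.length - m - (k + 1)) := by
  obtain ⟨⟨hca, hcr⟩, hγu, hγw⟩ := hγ
  have e : γ.length = γ.walk.length := rfl
  -- `|γ| ≥ k + m + 2`: otherwise `u = γ (k + 1) = γ (|γ| - m) = σ m` would be fixed
  have hL' : k + m + 2 ≤ γ.length := by
    by_contra h
    apply hu
    refine Or.inr ⟨m, le_rfl, ?_⟩
    rw [← hγu, ← hcr m le_rfl, Walk.getVert_reverse]
    congr 1
    omega
  have hw' : (γ.walk.drop (k + 1)).getVert (γ.length - m - (k + 2)) = w := by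
    rw [Walk.drop_getVert, ← hγw, Walk.getVert_reverse]
    congr 1
    omega
  set q : (discreteDomainGraph Ω δ).Walk u w :=
    ((γ.walk.drop (k + 1)).take (γ.length - m - (k + 2))).copy hγu hw' with hq
  have hqs : q.support = (γ.walk.support.drop (k + 1)).take (γ.length - m - (k + 1)) := by
    rw [hq, Walk.support_copy, Walk.support_take, Walk.drop_support_eq_support_drop_min,
      min_eq_left (by omega), show γ.length - m - (k + 2) + 1 = γ.length - m - (k + 1) by omega]
  have hqv : ∀ v ∈ q.support, v ∉ fixedSet k π m σ := by
    intro v hv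
    rw [hqs, List.mem_take_iff_getElem] at hv
    obtain ⟨j, hj, rfl⟩ := hv
    have hj' := hj
    simp only [List.length_drop, Walk.length_support, lt_min_iff] at hj'
    rw [List.getElem_drop, Walk.support_getElem_eq_getVert]
    exact getVert_not_mem_fixedSet ⟨hca, hcr⟩ (by omega) (by omega)
  have hqp : q.IsPath := by
    rw [hq, Walk.isPath_copy]
    exact (γ.isPath.drop _).take _
  exact ⟨⟨q.transfer (freeGraph Ω δ k π m σ) (edges_mem_edgeSet_freeGraph q hqv), hqp.transfer _⟩,
    by rw [Walk.support_transfer, hqs]⟩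

/-- BACKWARD: for a chord `γ₀` of the class with `k + m + 1 ≤ |γ₀|`, free `u ∼ π k`, `w ∼ σ m` and
a self-avoiding path `P : u → w` of the free graph, the splice
prefix-of-`γ₀` `· (π k → u) · P · (w → σ m) ·` suffix-of-`γ₀` is a chord of `dirSet k π m σ u w`
with support `[π 0, …, π k] ++ P.support ++ reverse [σ 0, …, σ m]`. [folklore] -/
theorem exists_chord {u w : Site 2} {γ₀ : SAW.DomainSAW Ω δ a b} (h₀ : γ₀ ∈ cls k π m σ)
    (hL₀ : k + m + 1 ≤ γ₀.length) (hu : u ∉ fixedSet k π m σ)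
    (hπu : (discreteDomainGraph Ω δ).Adj (π k) u) (hwσ : (discreteDomainGraph Ω δ).Adj w (σ m))
    (P : (freeGraph Ω δ k π m σ).Path u w) :
    ∃ γ : SAW.DomainSAW Ω δ a b, γ ∈ dirSet k π m σ u w ∧
      γ.walk.support =
        (List.range (k + 1)).map π ++ P.1.support ++ ((List.range (m + 1)).map σ).reverse := by
  have hs₀ := support_eq h₀ hL₀
  obtain ⟨h₀a, h₀r⟩ : AgreeTo k π γ₀ ∧ AgreeToR m σ γ₀ := h₀
  have e₀ : γ₀.length = γ₀.walk.length := rfl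
  have hXl : ((List.range (k + 1)).map π).length = k + 1 := by simp
  have hYl : ((List.range (m + 1)).map σ).length = m + 1 := by simp
  -- prefix `a → π k` and suffix `σ m → b` read off `γ₀`
  have hpk : γ₀.walk.getVert k = π k := h₀a k le_rfl
  have hsm : γ₀.walk.getVert (γ₀.walk.length - m) = σ m := by
    rw [← h₀r m le_rfl, Walk.getVert_reverse]
  have hX0 : γ₀.walk.support.take (k + 1) = (List.range (k + 1)).map π := by
    rw [hs₀, List.append_assoc, List.take_left' hXl]
  have hY0 : γ₀.walk.support.drop (γ₀.walk.length - m) = ((List.range (m + 1)).map σ).reverse := by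
    rw [hs₀, List.drop_left']
    rw [List.length_append, hXl, List.length_take, List.length_drop, Walk.length_support]
    omega
  -- the spliced walk, known through its support
  obtain ⟨W, hWs⟩ : ∃ W : (discreteDomainGraph Ω δ).Walk a b,
      W.support =
        (List.range (k + 1)).map π ++ P.1.support ++ ((List.range (m + 1)).map σ).reverse := by
    refine ⟨((γ₀.walk.take k).copy rfl hpk).append (Walk.cons hπu
      ((P.1.mapLe (freeGraph_le_domain k π m σ)).append
        (Walk.cons hwσ ((γ₀.walk.drop (γ₀.walk.length - m)).copy hsm rfl)))), ?_⟩
    rw [Walk.support_append, Walk.support_cons, List.tail_cons, Walk.support_append,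
      Walk.support_cons, List.tail_cons, Walk.support_mapLe_eq_support, Walk.support_copy,
      Walk.support_copy, Walk.support_take, Walk.drop_support_eq_support_drop_min,
      min_eq_left (by omega), hX0, hY0, List.append_assoc]
  have hWl : W.length = P.1.length + (k + m + 2) := by
    have h := congrArg List.length hWs
    simp only [Walk.length_support, List.length_append, List.length_map, List.length_range,
      List.length_reverse] at h
    omega
  have hPv : ∀ v ∈ P.1.support, v ∉ fixedSet k π m σ :=
    fun v hv => not_mem_fixedSet_of_mem_support P.1 hu hv
  -- it is self-avoiding
  have hWp : W.IsPath := by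
    rw [Walk.isPath_def, hWs, List.append_assoc, (List.perm_append_comm.append_left _).nodup_iff,
      ← List.append_assoc, List.nodup_append]
    refine ⟨?_, P.2.support_nodup, fun x hx y hy hxy => hPv y hy (mem_fixedSet_iff.2 (hxy ▸ hx))⟩
    have hsub : ((List.range (k + 1)).map π ++ ((List.range (m + 1)).map σ).reverse).Sublist
        γ₀.walk.support := by
      rw [hs₀, List.append_assoc]
      exact (List.sublist_append_right _ _).append_left _
    exact hsub.nodup γ₀.isPath.support_nodup
  -- prefix, suffix, next step and previous step
  have hget : ∀ i ≤ k, W.getVert i = π i := fun i hi => by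
    have h := W.getVert_eq_support_getElem? (show i ≤ W.length by omega)
    rw [hWs, List.append_assoc, List.getElem?_append_left (by rw [hXl]; omega), List.getElem?_map,
      List.getElem?_range (by omega)] at h
    simpa using h
  have hgetR : ∀ j ≤ m, W.reverse.getVert j = σ j := fun j hj => by
    have h := W.reverse.getVert_eq_support_getElem?
      (show j ≤ W.reverse.length by rw [Walk.length_reverse]; omega)
    rw [Walk.support_reverse, hWs, List.reverse_append, List.reverse_reverse,
      List.getElem?_append_left (by rw [hYl]; omega), List.getElem?_map,
      List.getElem?_range (by omega)] at h
    simpa using h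
  have hu' : W.getVert (k + 1) = u := by
    have h := W.getVert_eq_support_getElem? (show k + 1 ≤ W.length by omega)
    rw [hWs, List.append_assoc, List.getElem?_append_right hXl.le, hXl, Nat.sub_self,
      List.getElem?_append_left (by rw [Walk.length_support]; omega),
      ← P.1.getVert_eq_support_getElem? (Nat.zero_le _), Walk.getVert_zero, Option.some.injEq] at h
    exact h
  have hw' : W.reverse.getVert (m + 1) = w := by
    have h := W.reverse.getVert_eq_support_getElem?
      (show m + 1 ≤ W.reverse.length by rw [Walk.length_reverse]; omega)
    rw [Walk.support_reverse, hWs, List.reverse_append, List.reverse_reverse,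
      List.getElem?_append_right hYl.le, hYl, Nat.sub_self, List.reverse_append,
      List.getElem?_append_left (by rw [List.length_reverse, Walk.length_support]; omega),
      ← Walk.support_reverse, ← P.1.reverse.getVert_eq_support_getElem? (Nat.zero_le _),
      Walk.getVert_zero, Option.some.injEq] at h
    exact h
  exact ⟨⟨W, hWp⟩, ⟨⟨hget, hgetR⟩, hu', hw'⟩, hWs⟩

/-! ## The dictionary -/

/-- THE CLASS DICTIONARY for every chord type: see `ClassDictionaryAt`. [folklore] -/
theorem classDictionaryAt (Ω : Set ℂ) (δ : ℝ) (a b : Site 2) : ClassDictionaryAt Ω δ a b := by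
  intro k π m σ hex u w hu _hw hπu hwσ
  obtain ⟨γ₁, γ₂, h₁, h₂, hne⟩ := hex
  have hL : ∀ γ : SAW.DomainSAW Ω δ a b, γ ∈ cls k π m σ → k + m + 1 ≤ γ.length :=
    fun γ hγ => by
      by_cases h : γ = γ₁
      · rw [h]
        exact le_length h₁ h₂ hne
      · exact le_length hγ h₁ h
  have hF : ∀ γ : {γ : SAW.DomainSAW Ω δ a b // γ ∈ dirSet k π m σ u w},
      ∃ P : (freeGraph Ω δ k π m σ).Path u w,
        P.1.support = (γ.1.walk.support.drop (k + 1)).take (γ.1.length - m - (k + 1)) :=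
    fun γ => exists_middle γ.2 (hL γ.1 γ.2.1) hu
  have hB : ∀ P : (freeGraph Ω δ k π m σ).Path u w, ∃ γ : SAW.DomainSAW Ω δ a b,
      γ ∈ dirSet k π m σ u w ∧
        γ.walk.support =
          (List.range (k + 1)).map π ++ P.1.support ++ ((List.range (m + 1)).map σ).reverse :=
    fun P => exists_chord h₁ (hL γ₁ h₁) hu hπu hwσ P
  choose F hFs using hF
  choose B hBd hBs using hB
  have hXl : ((List.range (k + 1)).map π).length = k + 1 := by simp
  have hBl : ∀ P, (B P).length = P.1.length + (k + m + 2) := fun P => by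
    have h := congrArg List.length (hBs P)
    simp only [Walk.length_support, List.length_append, List.length_map, List.length_range,
      List.length_reverse] at h
    have e : (B P).length = (B P).walk.length := rfl
    omega
  refine ⟨⟨F, fun P => ⟨B P, hBd P⟩, fun γ => ?_, fun P => ?_⟩, fun γ => ?_, fun γ v => ?_⟩
  · -- chord ↦ middle ↦ chord
    apply Subtype.ext
    apply EndpointMonotone.ext_walk
    apply Walk.ext_support
    show (B (F γ)).walk.support = γ.1.walk.support
    rw [hBs (F γ), hFs γ]
    exact (support_eq γ.2.1 (hL γ.1 γ.2.1)).symm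
  · -- path ↦ chord ↦ middle
    apply Subtype.ext
    apply Walk.ext_support
    show (F ⟨B P, hBd P⟩).1.support = P.1.support
    rw [hFs ⟨B P, hBd P⟩]
    show ((B P).walk.support.drop (k + 1)).take ((B P).length - m - (k + 1)) = P.1.support
    have hPl : P.1.support.length = (B P).length - m - (k + 1) := by
      rw [Walk.length_support, hBl P]
      omega
    rw [hBs P, List.append_assoc, List.drop_left' hXl, List.take_left' hPl]
  · -- lengths
    show (F γ).1.length + (k + m + 2) = γ.1.length
    have h := congrArg List.length (hFs γ)
    simp only [Walk.length_support, List.length_take, List.length_drop] at h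
    have e : γ.1.length = γ.1.walk.length := rfl
    omega
  · -- supports
    show v ∈ (F γ).1.support ↔ _
    have e : γ.1.length = γ.1.walk.length := rfl
    rw [hFs γ, List.mem_take_iff_getElem]
    constructor
    · rintro ⟨j, hj, rfl⟩
      have hj' := hj
      simp only [List.length_drop, Walk.length_support, lt_min_iff] at hj'
      refine ⟨k + 1 + j, by omega, by omega, ?_⟩
      rw [List.getElem_drop, Walk.support_getElem_eq_getVert]
    · rintro ⟨i, hki, him, rfl⟩
      refine ⟨i - (k + 1), ?_, ?_⟩
      · simp only [List.length_drop, Walk.length_support, lt_min_iff]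
        omega
      · rw [List.getElem_drop, Walk.support_getElem_eq_getVert]
        congr 1
        omega

end ClassDictionary

/-- REGISTERED STUB `stub_classDictionary` of line `corner-localisation` (lead c1 reshape v5): the class
dictionary `ClassDictionaryAt Ω δ a b` for every chord type — chords of a prefix/suffix class with two
distinct members and prescribed free end-steps `(u, w)` ≃ self-avoiding paths `u → w` of the free graph,
lengths shifted by `k + m + 2`, supports = vertices at free positions. [folklore] -/
theorem stub_classDictionary : ∀ (Ω : Set ℂ) (δ : ℝ) (a b : Site 2), ClassDictionaryAt Ω δ a b :=
  ClassDictionary.classDictionaryAt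

end Summit.CriticalPhenomena.SAWScalingLimit.Theorems.LeftRightFKG.CornerLoc

end
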